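/-
Copyright: the b2b-balaban T⁴-continuum CRUX team, row NE7b OWNER lineage `t4-ne7b-p1` (gen 118). Project licence.
-/
import Summits.QuantumFields.BalabanUV.T4Continuum.Spine.NE7b.SupTorusEffectiveActionGradient

/-!
# THE NEXT EQUATION IS A BIJECTION OF THE COARSE CARRIER: in the convex regime `u′ ≥ −λ`, `λ < min(2,a)`, the renormalised source
# `λ(w) = Q′t(A(Ef Φ w) + u∘(Ef Φ w))` read at the torus background of the block field `w` (INST's next-equation map, `∇W = vol·λ`
# by (96)) attains EVERY coarse field EXACTLY ONCE — the effective action tilted by any linear source has exactly one critical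
# block field; with (94)'s strong monotonicity and (96)'s Lipschitz inverse, `w ↦ λ(w)` is a bi-Lipschitz correspondence between
# block fields and renormalised sources on the WHOLE carrier (the Legendre dual of the effective action is everywhere defined)
# (row NE7b, node U5c; (93) + (94) + (96) + TEA + INST BY NAME; [folklore])

Cell `pub-balaban`, sub-cell `t4`, spine estimate NE7b (`T4WeightBudget.RelWeightBound`; the cell's OWN estimate — NOT PRINTED in
[Bałaban 1983–89], NOT PROVED).  Crux-route work under `Spine/NE7b/` by the row OWNER (`t4-ne7b-p1` gen 118) under FREEZE (0)'s
crux-prover clause (convexity column); NOTHING of Bałaban's is named as a Lean object, valued or asserted; no `T4Continuum/Support`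
leaf typed; no `def`, no notation; zero `sorry`.  Imports (BY NAME): the OWNER's (96) `…SupTorusEffectiveActionGradient`
(`hasFDerivAt_fibreMin_comp` ∕ `fderiv_fibreMin_comp_apply_of_pairing` ∕ `exists_clm_blockLift`; through it (94)
`fibreCritical_firstOrder` ∕ `nextEquation_strongMonotone`, (93) `exists_isMinOn_of_firstOrder`, (89) `torus_form_coercive` ∕
`blockVolume_mul_sum_sq_blockAvg_le`, TEA `exists_clm_pair` ∕ `fderiv_action_eq_zero_of_pairing`, INST `pairing_of_sitewise`, TDF
`torus_operator_form_symm`, (93) `hasDerivAt_phiFour_potential`, (86) `hasDerivAt_phiFour`).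

WHY (located).  (94) made `w ↦ λ(w)` strongly monotone (injective, modulus `min(2,a) − λ`) and (96) read `∇W(w) = vol·λ(w)` with a
Lipschitz inverse; what was missing for a CORRESPONDENCE is surjectivity.  For a target source `c` tilt the effective action:
`W_c(w) = W(w) − vol·Σ_y c y·w y`.  The first-order letter of `W` at any base point ((94) `fibreCritical_firstOrder`, block Jensen)
is a first-order letter of `W_c` with modulus `(min(2,a) − λ)·vol > 0`, so the continuous `W_c` ((96): `W` is differentiable
everywhere) attains its minimum on the whole carrier ((93) `exists_isMinOn_of_firstOrder` with `F = univ`); at the minimiser the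
derivative `vol·⟨λ(w) − c, –⟩` vanishes, i.e. `λ(w) = c`.

WHAT IS PROVED ([folklore]):
* §1 (TEA's level: symmetric `At` with a form floor `γ`, `v′ = u`, `u′ ≥ −λ`, `λ < γ`; `Qt` with a right inverse `M`, block Jensen
  with `vol > 0`; `Φ` ANY map with `Qt(Φ w) = w` whose field equations pair like block lifts of `c(w)`) **`nextEquation_surjective`**
  (`∀ c, ∃ w, c(w) = c`), **`nextEquation_bijective`** (`∀ c, ∃! w, c(w) = c`).
* §2 (the `Beta.Site` carriers, displayed actions) THE END **`torus_nextEquation_bijective`** (ANY torus background map `Φ`: for every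
  coarse field `c` there is EXACTLY ONE block field `wt` whose background's renormalised source
  `y ↦ (n+1)^{−d}·Σ_{p′ ∈ B n (windowMap y)} ((A(Ef Φ wt))(p′) + u((Ef Φ wt)(p′)))` is `c`).
* §3 **`phiFour_nextEquation_bijective`** (`u t = g t³ + m t`, `0 ≤ g`, `−m < min(2,a)`).
* §4 toy.

HONEST (what this is NOT).  Finite-dimensional convex analysis by name; existence of the source-to-field inverse, no formula and no
locality for it; one-sided curvature; constants OURS; nothing about the measure; cubic periods; scalar skeleton, hard constraint, not
the covariant operators ((A3), NC-NE7b-α UNRULED); nothing of Bałaban's.  BY-NAME EFFECT ON THE WALL: NONE.  NE7b NOT PRINTED ∕ NOT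
PROVED; spine PROVED 0∕9; rung (B)+1 on a FINITE torus — NOT infinite volume, NOT the mass gap, NOT Clay.  HONEST DEPENDENCY:
continuum YM on T⁴ ⇐ BetaPertH ∧ nine spine estimates (0∕9 proved); BetaPertH ⇐ (D1) ∧ (D4) ∧ CAP+tail; G-an2-4 gates asym, D1 and
NE2∕3∕4.
-/

set_option autoImplicit false

noncomputable section

namespace Summit.QuantumFields.BalabanUV.T4Continuum.NE7b.SupTorusNextEquationBijective

open Set Function Filter
open scoped ENNReal Topology
open Literature.MathematicalPhysics.QuantumFieldTheory.Balaban1983to89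
open B6QGQLower276 (X blk B side AX)
open B5Hk103ScalarZd (nbhd)
open Beta (Site siteOf windowMap)
open SupTorusDirichletForm (torus_operator_form_symm)
open SupTorusDirichletFormCoercive (torus_form_coercive blockVolume_mul_sum_sq_blockAvg_le)
open SupTorusEffectiveAction (exists_clm_pair fderiv_action_eq_zero_of_pairing)
open SupTorusEffectiveActionInstance (pairing_of_sitewise)
open SupTorusActionMinimiser (exists_isMinOn_of_firstOrder hasDerivAt_phiFour_potential)
open SupTorusEffectiveActionConvex (fibreCritical_firstOrder nextEquation_strongMonotone)
open SupTorusEffectiveActionGradient (hasFDerivAt_fibreMin_comp fderiv_fibreMin_comp_apply_of_pairing exists_clm_blockLift)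
open SupPhiFourBackground (hasDerivAt_phiFour)

variable {d : ℕ}

/-! ## §1. TEA's level: the next equation is onto, hence a bijection -/

section Generic

variable {ι κ : Type*} [Fintype ι] [Fintype κ]

/-- **THE NEXT EQUATION IS ONTO** (symmetric `At` with a form floor `γ`, `v′ = u`, `u′` a derivative of `u`, `u′ ≥ −λ`, `λ < γ`;
`Qt` with a continuous linear right inverse `M` and the block Jensen letter `vol·Σ_y (Qt h)² ≤ Σ_x h²`, `vol > 0`; `Φ` ANY map
with `Qt(Φ w) = w` whose field equation at every `w` pairs like the block lift of `cw w`):  for every source `c` there is a block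
field `w` with `cw w = c` — the minimiser of the tilted effective action `w ↦ S(Φ w) − vol·Σ_y c y·w y`. [folklore] -/
theorem nextEquation_surjective (At : (ι → ℝ) →L[ℝ] (ι → ℝ))
    (hAt : ∀ φ ψ : ι → ℝ, ∑ x, ψ x * At φ x = ∑ x, φ x * At ψ x) {γ : ℝ}
    (hγ : ∀ h : ι → ℝ, γ * ∑ x, h x ^ 2 ≤ ∑ x, h x * At h x) {v u u' : ℝ → ℝ} (hv : ∀ t, HasDerivAt v (u t) t)
    (hu : ∀ t, HasDerivAt u (u' t) t) {lam : ℝ} (hu' : ∀ t, -lam ≤ u' t) (hγlam : lam < γ)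
    (Qt : (ι → ℝ) →L[ℝ] (κ → ℝ)) (M : (κ → ℝ) →L[ℝ] (ι → ℝ)) (hM : ∀ k : κ → ℝ, Qt (M k) = k) {vol : ℝ} (hvol : 0 < vol)
    (hJ : ∀ h : ι → ℝ, vol * ∑ y, Qt h y ^ 2 ≤ ∑ x, h x ^ 2)
    (Φ : (κ → ℝ) → (ι → ℝ)) (hΦQ : ∀ w, Qt (Φ w) = w) (cw : (κ → ℝ) → (κ → ℝ))
    (hpair : ∀ (w : κ → ℝ) (h : ι → ℝ), ∑ x, (At (Φ w) x + u (Φ w x)) * h x = vol * ∑ y, cw w y * Qt h y)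
    (c : κ → ℝ) : ∃ w : κ → ℝ, cw w = c := by
  have hΦcrit : ∀ (w : κ → ℝ) (h : ι → ℝ), Qt h = 0 →
      fderiv ℝ (fun φ : ι → ℝ => (1 / 2 : ℝ) * ∑ x, φ x * At φ x + ∑ x, v (φ x)) (Φ w) h = 0 :=
    fun w h hh => fderiv_action_eq_zero_of_pairing At hAt hv Qt (hpair w) h hh
  -- the effective action and its derivative at every point
  have hW : ∀ w : κ → ℝ, HasFDerivAt (fun w' : κ → ℝ => (1 / 2 : ℝ) * ∑ x, Φ w' x * At (Φ w') x + ∑ x, v (Φ w' x))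
      ((fderiv ℝ (fun φ : ι → ℝ => (1 / 2 : ℝ) * ∑ x, φ x * At φ x + ∑ x, v (φ x)) (Φ w)).comp M) w := fun w =>
    hasFDerivAt_fibreMin_comp At hAt hγ hv hu hu' hγlam.le Qt M hM Φ hΦQ hΦcrit w
  have hWcont : Continuous (fun w' : κ → ℝ => (1 / 2 : ℝ) * ∑ x, Φ w' x * At (Φ w') x + ∑ x, v (Φ w' x)) :=
    continuous_iff_continuousAt.2 fun w => (hW w).continuousAt
  -- the tilt
  obtain ⟨Lc, hLc⟩ := exists_clm_pair (ι := κ) (fun y => vol * c y)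
  have hTcont : Continuous (fun w' : κ → ℝ =>
      ((1 / 2 : ℝ) * ∑ x, Φ w' x * At (Φ w') x + ∑ x, v (Φ w' x)) - Lc w') := hWcont.sub Lc.continuous
  -- the first-order letter of the tilted effective action at `w₀ = 0`
  obtain ⟨L, hL⟩ := exists_clm_pair (ι := κ) (fun y => vol * (cw 0 y - c y))
  have hfo : ∀ ψ ∈ (univ : Set (κ → ℝ)),
      (((1 / 2 : ℝ) * ∑ x, Φ 0 x * At (Φ 0) x + ∑ x, v (Φ 0 x)) - Lc 0) + L (ψ - 0)
          + (γ - lam) * vol / 2 * ∑ y, (ψ y - (0 : κ → ℝ) y) ^ 2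
        ≤ ((1 / 2 : ℝ) * ∑ x, Φ ψ x * At (Φ ψ) x + ∑ x, v (Φ ψ x)) - Lc ψ := by
    intro ψ _
    have h1 := fibreCritical_firstOrder At hAt hγ hv hu hu' hγlam.le Qt hJ (hpair 0) (Φ ψ)
    rw [hΦQ, hΦQ] at h1
    rw [map_zero, sub_zero, hL, hLc]
    simp only [Pi.sub_apply, Pi.zero_apply, sub_zero] at h1 ⊢
    have hsplit : ∑ y, vol * (cw 0 y - c y) * ψ y = vol * ∑ y, cw 0 y * ψ y - ∑ y, vol * c y * ψ y := by
      rw [Finset.mul_sum, ← Finset.sum_sub_distrib]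
      exact Finset.sum_congr rfl fun y _ => by ring
    rw [hsplit]
    have hm : (γ - lam) * vol / 2 * ∑ y, ψ y ^ 2 = (γ - lam) / 2 * (vol * ∑ y, ψ y ^ 2) := by ring
    rw [hm]
    linarith
  obtain ⟨w, -, hmin⟩ := exists_isMinOn_of_firstOrder (ι := κ) hTcont isClosed_univ (mem_univ (0 : κ → ℝ))
    (m := (γ - lam) * vol) (mul_pos (sub_pos.2 hγlam) hvol) hfo
  -- at the minimiser the derivative `vol·⟨cw w − c, –⟩` vanishes
  have hder : HasFDerivAt (fun w' : κ → ℝ =>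
      ((1 / 2 : ℝ) * ∑ x, Φ w' x * At (Φ w') x + ∑ x, v (Φ w' x)) - Lc w')
      (((fderiv ℝ (fun φ : ι → ℝ => (1 / 2 : ℝ) * ∑ x, φ x * At φ x + ∑ x, v (φ x)) (Φ w)).comp M) - Lc) w :=
    (hW w).sub Lc.hasFDerivAt
  have hzero := (hmin.isLocalMin univ_mem).hasFDerivAt_eq_zero hder
  refine ⟨w, ?_⟩
  -- test against `cw w − c`
  have hk : ∀ k : κ → ℝ, vol * ∑ y, (cw w y - c y) * k y = 0 := fun k => by
    have h1 := congrArg (fun T : (κ → ℝ) →L[ℝ] ℝ => T k) hzero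
    simp only [sub_apply, zero_apply] at h1
    rw [fderiv_fibreMin_comp_apply_of_pairing At hAt hv Qt M hM (hpair w) k, hLc] at h1
    rw [← h1, Finset.mul_sum, Finset.mul_sum, ← Finset.sum_sub_distrib]
    exact Finset.sum_congr rfl fun y _ => by ring
  have hsq : ∑ y, (cw w y - c y) ^ 2 = 0 := by
    have h1 := hk (fun y => cw w y - c y)
    have h2 : ∑ y, (cw w y - c y) * (cw w y - c y) = ∑ y, (cw w y - c y) ^ 2 := Finset.sum_congr rfl fun y _ => by ring
    rw [h2] at h1
    rcases mul_eq_zero.1 h1 with h3 | h3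
    · exact absurd h3 (ne_of_gt hvol)
    · exact h3
  funext y
  have hy := (Finset.sum_eq_zero_iff_of_nonneg fun y _ => sq_nonneg (cw w y - c y)).1 hsq y (Finset.mem_univ y)
  rw [sq_eq_zero_iff, sub_eq_zero] at hy
  exact hy

/-- **THE NEXT EQUATION IS A BIJECTION**: under the same letters, for every source `c` there is EXACTLY ONE block field `w` with
`cw w = c` (surjective by `nextEquation_surjective`, injective by (94)'s strong monotonicity). [folklore] -/
theorem nextEquation_bijective (At : (ι → ℝ) →L[ℝ] (ι → ℝ))
    (hAt : ∀ φ ψ : ι → ℝ, ∑ x, ψ x * At φ x = ∑ x, φ x * At ψ x) {γ : ℝ}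
    (hγ : ∀ h : ι → ℝ, γ * ∑ x, h x ^ 2 ≤ ∑ x, h x * At h x) {v u u' : ℝ → ℝ} (hv : ∀ t, HasDerivAt v (u t) t)
    (hu : ∀ t, HasDerivAt u (u' t) t) {lam : ℝ} (hu' : ∀ t, -lam ≤ u' t) (hγlam : lam < γ)
    (Qt : (ι → ℝ) →L[ℝ] (κ → ℝ)) (M : (κ → ℝ) →L[ℝ] (ι → ℝ)) (hM : ∀ k : κ → ℝ, Qt (M k) = k) {vol : ℝ} (hvol : 0 < vol)
    (hJ : ∀ h : ι → ℝ, vol * ∑ y, Qt h y ^ 2 ≤ ∑ x, h x ^ 2)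
    (Φ : (κ → ℝ) → (ι → ℝ)) (hΦQ : ∀ w, Qt (Φ w) = w) (cw : (κ → ℝ) → (κ → ℝ))
    (hpair : ∀ (w : κ → ℝ) (h : ι → ℝ), ∑ x, (At (Φ w) x + u (Φ w x)) * h x = vol * ∑ y, cw w y * Qt h y)
    (c : κ → ℝ) : ∃! w : κ → ℝ, cw w = c := by
  obtain ⟨w, hw⟩ := nextEquation_surjective At hAt hγ hv hu hu' hγlam Qt M hM hvol hJ Φ hΦQ cw hpair c
  refine ⟨w, hw, fun w' hw' => ?_⟩
  -- strong monotonicity: `(γ − λ)·vol·Σ (w′ − w)² ≤ vol·Σ (c − c)·(w′ − w) = 0`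
  have hmono := nextEquation_strongMonotone At hAt hγ hv hu hu' hγlam.le Qt hJ (hpair w') (hpair w)
  rw [hΦQ, hΦQ, hw, hw'] at hmono
  simp only [sub_self, zero_mul, Finset.sum_const_zero, mul_zero] at hmono
  have hpos : 0 < (γ - lam) * vol := mul_pos (sub_pos.2 hγlam) hvol
  have hnn : 0 ≤ ∑ y, (w' y - w y) ^ 2 := Finset.sum_nonneg fun y _ => sq_nonneg _
  have hsq : ∑ y, (w' y - w y) ^ 2 = 0 := le_antisymm (by nlinarith [hmono, hpos, hnn]) hnn
  funext y
  have hy := (Finset.sum_eq_zero_iff_of_nonneg fun y _ => sq_nonneg (w' y - w y)).1 hsq y (Finset.mem_univ y)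
  rw [sq_eq_zero_iff, sub_eq_zero] at hy
  exact hy

end Generic

/-! ## §2. The torus: every renormalised source is attained by exactly one block field -/

section Torus

variable (n : ℕ) (a : ℝ) (s : ℕ) [NeZero s]
  {Dop Aop : lp (fun _ : X d => ℝ) ∞ →L[ℝ] lp (fun _ : X d => ℝ) ∞}
  (hD : ∀ (f : lp (fun _ : X d => ℝ) ∞) (y : X d), Dop f y = (((n : ℝ) + 1) ^ d)⁻¹ * ∑ p ∈ B n y, f p)
  (hA : ∀ (f : lp (fun _ : X d => ℝ) ∞) (p : X d), Aop f p = ∑ r ∈ nbhd n p, AX n a p r * f r)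
  {v u u' : ℝ → ℝ} (hv : ∀ t, HasDerivAt v (u t) t) (hu : ∀ t, HasDerivAt u (u' t) t)
  {lam : ℝ} (hu' : ∀ t, -lam ≤ u' t) (hγ : lam < min 2 a)
  {Ef : (Site d ((n + 1) * s) → ℝ) →L[ℝ] lp (fun _ : X d => ℝ) ∞}
  (hEf : ∀ (g : Site d ((n + 1) * s) → ℝ) (q : X d), Ef g q = g (siteOf d ((n + 1) * s) q))
  {Rf : lp (fun _ : X d => ℝ) ∞ →L[ℝ] (Site d ((n + 1) * s) → ℝ)}
  (hRf : ∀ (h : lp (fun _ : X d => ℝ) ∞) (x : Site d ((n + 1) * s)), Rf h x = h (windowMap d ((n + 1) * s) x))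
  {Rc : lp (fun _ : X d => ℝ) ∞ →L[ℝ] (Site d s → ℝ)}
  (hRc : ∀ (h : lp (fun _ : X d => ℝ) ∞) (x : Site d s), Rc h x = h (windowMap d s x))

include hD hA hv hu hu' hγ hEf hRf hRc in
/-- **THE END: THE TORUS NEXT EQUATION IS A BIJECTION OF THE COARSE CARRIER.**  `v′ = u`, `u′` a derivative of `u`, `u′ ≥ −λ` on `ℝ`,
`λ < min(2,a)`; `Φ` ANY background map (block means `Q′t(Φ w) = w` and the sitewise equation at every `w` — exists uniquely by
(93)).  For EVERY coarse field `c` there is EXACTLY ONE block field `wt` whose background's renormalised source — INST's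
next-equation reading `y ↦ (n+1)^{−d}·Σ_{p′ ∈ B n (windowMap y)} ((A(Ef Φ wt))(p′) + u((Ef Φ wt)(p′)))` — equals `c`; every
mesh, period, dimension; no smallness of `c`. [folklore] -/
theorem torus_nextEquation_bijective (Φ : (Site d s → ℝ) → (Site d ((n + 1) * s) → ℝ))
    (hΦQ : ∀ w : Site d s → ℝ, ((Rc.comp Dop).comp Ef) (Φ w) = w)
    (hΦeq : ∀ (w : Site d s → ℝ) (p : X d), Aop (Ef (Φ w)) p + u (Ef (Φ w) p)
      = (((n : ℝ) + 1) ^ d)⁻¹ * ∑ p' ∈ B n (blk n p), (Aop (Ef (Φ w)) p' + u (Ef (Φ w) p')))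
    (c : Site d s → ℝ) :
    ∃! wt : Site d s → ℝ, (fun y : Site d s =>
      (((n : ℝ) + 1) ^ d)⁻¹ * ∑ p' ∈ B n (windowMap d s y), (Aop (Ef (Φ wt)) p' + u (Ef (Φ wt) p'))) = c := by
  obtain ⟨M, -, hM⟩ := exists_clm_blockLift n s hD hEf hRc
  exact nextEquation_bijective ((Rf.comp Aop).comp Ef) (torus_operator_form_symm n a s hA hEf hRf)
    (torus_form_coercive n a s hA hEf hRf) hv hu hu' hγ ((Rc.comp Dop).comp Ef) M hM
    (by positivity : (0 : ℝ) < ((n : ℝ) + 1) ^ d)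
    (fun h => by simpa only [ContinuousLinearMap.comp_apply] using blockVolume_mul_sum_sq_blockAvg_le n s hD hEf hRc h) Φ hΦQ
    (fun w y => (((n : ℝ) + 1) ^ d)⁻¹ * ∑ p' ∈ B n (windowMap d s y), (Aop (Ef (Φ w)) p' + u (Ef (Φ w) p')))
    (fun w h => pairing_of_sitewise n a s hD hA hEf hRf hRc (Φ w) u (hΦeq w) h) c

end Torus

/-! ## §3. Lattice `φ⁴`: the renormalised source determines the block field, and every source occurs -/

/-- **THE `φ⁴_d` NEXT EQUATION IS A BIJECTION** (`u t = g t³ + m t`, `0 ≤ g`, `−m < min(2,a)`; every side, period, dimension; ANY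
operators ∕ carrier maps with the displayed actions; `Φ` ANY map with block means `w` and the `φ⁴` sitewise equation at every `w` —
exists uniquely by (93)): every coarse field is the renormalised source of exactly one block field. [folklore] -/
theorem phiFour_nextEquation_bijective (n : ℕ) (a : ℝ) (s : ℕ) [NeZero s]
    {Dop Aop : lp (fun _ : X d => ℝ) ∞ →L[ℝ] lp (fun _ : X d => ℝ) ∞}
    (hD : ∀ (f : lp (fun _ : X d => ℝ) ∞) (y : X d), Dop f y = (((n : ℝ) + 1) ^ d)⁻¹ * ∑ p ∈ B n y, f p)
    (hA : ∀ (f : lp (fun _ : X d => ℝ) ∞) (p : X d), Aop f p = ∑ r ∈ nbhd n p, AX n a p r * f r)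
    {Ef : (Site d ((n + 1) * s) → ℝ) →L[ℝ] lp (fun _ : X d => ℝ) ∞}
    (hEf : ∀ (g : Site d ((n + 1) * s) → ℝ) (q : X d), Ef g q = g (siteOf d ((n + 1) * s) q))
    {Rf : lp (fun _ : X d => ℝ) ∞ →L[ℝ] (Site d ((n + 1) * s) → ℝ)}
    (hRf : ∀ (h : lp (fun _ : X d => ℝ) ∞) (x : Site d ((n + 1) * s)), Rf h x = h (windowMap d ((n + 1) * s) x))
    {Rc : lp (fun _ : X d => ℝ) ∞ →L[ℝ] (Site d s → ℝ)}
    (hRc : ∀ (h : lp (fun _ : X d => ℝ) ∞) (x : Site d s), Rc h x = h (windowMap d s x))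
    {g m : ℝ} (hg : 0 ≤ g) (hm : -m < min 2 a)
    (Φ : (Site d s → ℝ) → (Site d ((n + 1) * s) → ℝ))
    (hΦQ : ∀ w : Site d s → ℝ, ((Rc.comp Dop).comp Ef) (Φ w) = w)
    (hΦeq : ∀ (w : Site d s → ℝ) (p : X d), Aop (Ef (Φ w)) p + (g * (Ef (Φ w) p) ^ 3 + m * Ef (Φ w) p)
      = (((n : ℝ) + 1) ^ d)⁻¹ * ∑ p' ∈ B n (blk n p), (Aop (Ef (Φ w)) p' + (g * (Ef (Φ w) p') ^ 3 + m * Ef (Φ w) p')))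
    (c : Site d s → ℝ) :
    ∃! wt : Site d s → ℝ, (fun y : Site d s => (((n : ℝ) + 1) ^ d)⁻¹ *
      ∑ p' ∈ B n (windowMap d s y), (Aop (Ef (Φ wt)) p' + (g * (Ef (Φ wt) p') ^ 3 + m * Ef (Φ wt) p'))) = c :=
  torus_nextEquation_bijective n a s hD hA (v := fun t => g / 4 * t ^ 4 + m / 2 * t ^ 2)
    (u := fun t => g * t ^ 3 + m * t) (u' := fun t => 3 * g * t ^ 2 + m) (hasDerivAt_phiFour_potential g m)
    (hasDerivAt_phiFour g m) (lam := -m) (fun t => by nlinarith [sq_nonneg t]) (by simpa using hm) hEf hRf hRc Φ hΦQ hΦeq c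

/-! ## §4. Toy -/

/-- Toy (§1 on one fine and one coarse site: `At = 1` (floor `1`), `v = u = u′ = 0`, `λ = 0`, `Qt = M = 1`, `vol = 1`, `Φ = id`,
`cw w = w`): the next equation `w ↦ w` attains every source exactly once. -/
example (c : Unit → ℝ) : ∃! w : Unit → ℝ, (fun w : Unit → ℝ => w) w = c :=
  nextEquation_bijective (ι := Unit) (κ := Unit) 1 (fun φ ψ => by simp [mul_comm]) (γ := 1)
    (fun h => by simp [sq]) (v := fun _ => 0) (u := fun _ => 0) (u' := fun _ => 0)
    (fun t => by simpa using hasDerivAt_const t (0 : ℝ)) (fun t => by simpa using hasDerivAt_const t (0 : ℝ)) (lam := 0)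
    (fun _ => by norm_num) one_pos (ContinuousLinearMap.id ℝ (Unit → ℝ)) (ContinuousLinearMap.id ℝ (Unit → ℝ)) (fun _ => rfl)
    one_pos (fun h => by simp) id (fun _ => rfl) (fun w => w) (fun w h => by simp) c

end Summit.QuantumFields.BalabanUV.T4Continuum.NE7b.SupTorusNextEquationBijective

end
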